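import Literature.Probability.RandomPlanarGeometry.SAWTriangularStrip
import HarnessLib

/-!
# Bridges of the triangular lattice inside a row strip: `b_N(𝕋) ≤ (2N+1) · B` and `B^{2j} ≤ c_{2jN}(S_{4N})`

Topic `Literature/Probability/RandomPlanarGeometry` (continues `SAWTriangularStrip.lean` — the row strips
`S_T = {0 ≤ Y ≤ T}` of `𝕋` in brick coordinates, `TriStrip.stripCount T N = c_N(S_T)` — and `SAWTriangularBridges.lean`
— the bridges `brickBridges N` of `𝕋` by the brick height `X` (Madras–Slade Definition 1.2.4), `b_N(𝕋)`,
`concatWalk_mem_brickSaws`).  Source: N. Madras, G. Slade, *The Self-Avoiding Walk* (1993), §8.2, proof of Theorem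
8.2.1, p. 269–270, transplanted from `ℤ^d` (tree `SAWTubeBridges.lean`: height classes, pigeonhole, REFLECTION PAIRS,
level bridges) to the triangular lattice; the honeycomb twin is `HexSAWBrickWallStripBridges.lean`.

## The mechanism on `𝕋`

In brick coordinates the row reversal `negY : (X, Y) ↦ (X, −Y)` IS an automorphism of `𝕋` (the step set
`(±2,0), (±1,±1)` is symmetric) fixing the origin and the height, so the `ℤ^d` device applies letter by letter: a bridge
of the end-row class `h` followed by the reflection of another one is a `2N`-step bridge ending on the starting row, all
of whose sites are within `2N` rows of the start; such blocks concatenate by translation, stay within `2N` rows for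
ever, and — started on row `2N` — lie in `S_{4N}`.  No parity restriction on `N` (contrast the honeycomb file).

## Contents (namespace `Literature.Probability.RandomPlanarGeometry.SAW.TriStrip`, all PROVED)

* `brickGraph_adj_negY_iff`, `negWalk` (+ `negWalk_mem_brickSaws`, `negWalk_mem_brickBridges`, `negWalk_injective`),
  `concatWalk_mem_brickBridges` (the tree's bridge concatenation, as a named lemma), `concatWalk_injective_pieces`
  (the values of `Zd.concatWalk` before/after the gluing time are private helpers);
* `rowOffsets`, `rowClass`, `levelBridges`, `abs_apply_one_le`, `exists_rowClass` (pigeonhole);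
* `sq_card_rowClass_le` (`(#rowClass N h)² ≤ #levelBridges 2N 2N`, reflection pairs), `card_levelBridges_mul_le`,
  `card_levelBridges_pow_le`, `card_levelBridges_le_stripCount`, **`exists_pow_le_stripCount`**.
-/

noncomputable section

open Finset Literature.Probability.LatticeModels Literature.Probability.Percolation SimpleGraph

namespace Literature.Probability.RandomPlanarGeometry.SAW

namespace TriStrip

open HexBW (InStrip stripStarts negY negY_apply_zero negY_apply_one negY_negY negY_injective negY_zero
  mem_stripStarts)
open Zd (concatWalk)

/-! ### The row reversal and the concatenation of bridges -/

/-- The row reversal `(X, Y) ↦ (X, −Y)` is an automorphism of the triangular lattice in brick coordinates.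
[cite: Grimmett2018, §5.5] -/
theorem brickGraph_adj_negY_iff (x y : Site 2) : brickGraph.Adj (negY x) (negY y) ↔ brickGraph.Adj x y := by
  simp only [brickGraph_adj_iff, negY_apply_zero, negY_apply_one]
  omega

/-- The reflected walk. [cite: MadrasSlade1993, §8.2, proof of Theorem 8.2.1] -/
def negWalk (ω : ℕ → Site 2) : ℕ → Site 2 := fun i => negY (ω i)

/-- Reflection preserves the walks of `𝕋`. [cite: MadrasSlade1993, §8.2, proof of Theorem 8.2.1] -/
theorem negWalk_mem_brickSaws {n : ℕ} {ω : ℕ → Site 2} (hω : ω ∈ brickSaws n) : negWalk ω ∈ brickSaws n := by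
  obtain ⟨h0, hend, hadj, hinj⟩ := mem_brickSaws.1 hω
  refine mem_brickSaws.2 ⟨by simp [negWalk, h0], fun i hi => by simp [negWalk, hend i hi],
    fun i hi => (brickGraph_adj_negY_iff _ _).2 (hadj i hi), fun i hi j hj hij => hinj hi hj (negY_injective hij)⟩

/-- Reflection preserves bridges (heights are untouched). [cite: MadrasSlade1993, §8.2, proof of Theorem 8.2.1] -/
theorem negWalk_mem_brickBridges {n : ℕ} {ω : ℕ → Site 2} (hω : ω ∈ brickBridges n) :
    negWalk ω ∈ brickBridges n := by
  obtain ⟨hS, hb⟩ := mem_brickBridges.1 hω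
  refine mem_brickBridges.2 ⟨negWalk_mem_brickSaws hS, fun i h1 h2 => ?_⟩
  simpa only [negWalk, negY_apply_zero] using hb i h1 h2

/-- Reflection is injective. [cite: MadrasSlade1993, §8.2] -/
theorem negWalk_injective : Function.Injective negWalk := fun _ _ h =>
  funext fun i => negY_injective (congrFun h i)

/-- Values of `concatWalk` up to the gluing time. [cite: MadrasSlade1993, §1.2, eq. (1.2.15)] -/
private theorem concatWalk_apply_of_le {m i : ℕ} (ω υ : ℕ → Site 2) (hi : i ≤ m) : concatWalk m ω υ i = ω i :=
  if_pos hi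

/-- Values of `concatWalk` after the gluing time. [cite: MadrasSlade1993, §1.2, eq. (1.2.15)] -/
private theorem concatWalk_apply_add {m : ℕ} (ω υ : ℕ → Site 2) (h0 : υ 0 = 0) (j : ℕ) :
    concatWalk m ω υ (m + j) = ω m + υ j := by
  rcases Nat.eq_zero_or_pos j with rfl | hj
  · rw [h0, add_zero, add_zero, concatWalk_apply_of_le ω υ le_rfl]
  · have h : ¬ m + j ≤ m := by omega
    simp only [concatWalk, if_neg h, Nat.add_sub_cancel_left]

/-- **The concatenation of two bridges of `𝕋` is a bridge** (the tree's `brickBridgeCount_mul_le` argument as a named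
lemma). [cite: MadrasSlade1993, §1.2, eq. (1.2.15)] -/
theorem concatWalk_mem_brickBridges {m n : ℕ} {ω υ : ℕ → Site 2} (hω : ω ∈ brickBridges m)
    (hυ : υ ∈ brickBridges n) : concatWalk m ω υ ∈ brickBridges (m + n) := by
  obtain ⟨hωS, hωb⟩ := mem_brickBridges.1 hω
  obtain ⟨hυS, hυb⟩ := mem_brickBridges.1 hυ
  have hω0 := (mem_brickSaws.1 hωS).1
  have hυ0 := (mem_brickSaws.1 hυS).1
  have h00 : (0 : Site 2) 0 = 0 := rfl
  have hle : ∀ i ≤ m, ω i 0 ≤ ω m 0 := by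
    intro i hi
    rcases Nat.eq_zero_or_pos i with rfl | hpos
    · rcases Nat.eq_zero_or_pos m with rfl | hm
      · exact le_rfl
      · exact (hωb m hm le_rfl).1.le
    · exact (hωb i hpos hi).2
  have hυn : 0 ≤ υ n 0 := by
    rcases Nat.eq_zero_or_pos n with rfl | hn
    · rw [hυ0, h00]
    · have := (hυb n hn le_rfl).1
      rw [hυ0, h00] at this
      exact this.le
  have hgt : ∀ j, 1 ≤ j → j ≤ n → ω m 0 < (ω m + υ j) 0 := by
    intro j h1 h2
    have := (hυb j h1 h2).1
    rw [hυ0, h00] at this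
    simp only [Pi.add_apply]
    linarith
  refine mem_brickBridges.2 ⟨concatWalk_mem_brickSaws hωS hυS fun i hi j h1 h2 heq => ?_, ?_⟩
  · have ha := hle i hi
    have hb := hgt j h1 h2
    rw [← heq] at hb
    linarith
  · intro i h1 h2
    have hstart : concatWalk m ω υ 0 = 0 := by simp [concatWalk, hω0]
    have hlast : concatWalk m ω υ (m + n) 0 = ω m 0 + υ n 0 := by
      rw [concatWalk_apply_add ω υ hυ0 n, Pi.add_apply]
    rw [hstart, hlast, h00]
    by_cases h : i ≤ m
    · rw [concatWalk_apply_of_le ω υ h]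
      have := (hωb i h1 h).1
      rw [hω0, h00] at this
      exact ⟨this, (hle i h).trans (by linarith)⟩
    · obtain ⟨j, rfl⟩ : ∃ j, i = m + j := ⟨i - m, by omega⟩
      rw [concatWalk_apply_add ω υ hυ0 j, Pi.add_apply]
      have := hυb j (by omega) (by omega)
      rw [hυ0, h00] at this
      have hm0 : 0 ≤ ω m 0 := by have := hle 0 (Nat.zero_le m); rwa [hω0] at this
      exact ⟨by linarith [this.1], by linarith [this.2]⟩

/-- Gluing at a fixed time is injective in the two pieces. [cite: MadrasSlade1993, §1.2, eq. (1.2.15)] -/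
theorem concatWalk_injective_pieces {m t t' : ℕ} {ω υ ω' υ' : ℕ → Site 2} (hω : ω ∈ brickSaws m)
    (hυ : υ ∈ brickSaws t) (hω' : ω' ∈ brickSaws m) (hυ' : υ' ∈ brickSaws t')
    (h : concatWalk m ω υ = concatWalk m ω' υ') : ω = ω' ∧ υ = υ' := by
  have hωs := mem_brickSaws.1 hω
  have hυs := mem_brickSaws.1 hυ
  have hω's := mem_brickSaws.1 hω'
  have hυ's := mem_brickSaws.1 hυ'
  have hm : ω m = ω' m := by
    have := congrFun h m
    rwa [concatWalk_apply_of_le ω υ le_rfl, concatWalk_apply_of_le ω' υ' le_rfl] at this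
  have h1 : ω = ω' := funext fun i => (le_or_gt i m).elim
    (fun hi => by simpa only [concatWalk_apply_of_le _ _ hi] using congrFun h i)
    fun hi => by rw [hωs.2.1 i hi.le, hω's.2.1 i hi.le, hm]
  refine ⟨h1, funext fun j => ?_⟩
  have := congrFun h (m + j)
  rwa [concatWalk_apply_add ω υ hυs.1, concatWalk_apply_add ω' υ' hυ's.1, hm, add_right_inj] at this

/-! ### Row classes, level bridges, pigeonhole -/

/-- The possible end rows of an `N`-step walk of `𝕋` from the origin: `{−N,…,N}`. [cite: MadrasSlade1993, §8.2] -/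
def rowOffsets (N : ℕ) : Finset ℤ := Finset.Icc (-(N : ℤ)) N

open Classical in
/-- The class of `N`-step bridges of `𝕋` ending on row `h`. [cite: MadrasSlade1993, §8.2, proof of Theorem 8.2.1] -/
def rowClass (N : ℕ) (h : ℤ) : Finset (ℕ → Site 2) := (brickBridges N).filter fun ω => ω N 1 = h

open Classical in
/-- The **level bridges** of `𝕋`: `M`-step bridges from `0` ending on row `0` with all sites within `W` rows of the start.
[cite: MadrasSlade1993, §8.2, proof of Theorem 8.2.1] -/
def levelBridges (W M : ℕ) : Finset (ℕ → Site 2) :=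
  (brickBridges M).filter fun ω => ω M 1 = 0 ∧ ∀ m ≤ M, |ω m 1| ≤ W

/-- `#rowOffsets N = 2N+1`. [cite: MadrasSlade1993, §8.2] -/
theorem card_rowOffsets (N : ℕ) : (rowOffsets N).card = 2 * N + 1 := by
  rw [rowOffsets, Int.card_Icc]
  omega

/-- Membership in `rowClass`. [cite: MadrasSlade1993, §8.2] -/
theorem mem_rowClass {N : ℕ} {h : ℤ} {ω : ℕ → Site 2} : ω ∈ rowClass N h ↔ ω ∈ brickBridges N ∧ ω N 1 = h := by
  classical
  exact Finset.mem_filter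

/-- Membership in `levelBridges`. [cite: MadrasSlade1993, §8.2] -/
theorem mem_levelBridges {W M : ℕ} {ω : ℕ → Site 2} :
    ω ∈ levelBridges W M ↔ ω ∈ brickBridges M ∧ ω M 1 = 0 ∧ ∀ m ≤ M, |ω m 1| ≤ W := by
  classical
  exact Finset.mem_filter

/-- After `m ≤ N` steps a walk of `𝕋` from the origin is within `m` rows of the start (each step moves the row by at
most one). [cite: MadrasSlade1993, §1.1] -/
theorem abs_apply_one_le {N : ℕ} {ω : ℕ → Site 2} (hω : ω ∈ brickSaws N) : ∀ {m : ℕ}, m ≤ N → |ω m 1| ≤ (m : ℤ) := by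
  obtain ⟨h0, -, hadj, -⟩ := mem_brickSaws.1 hω
  intro m
  induction m with
  | zero => intro _; simp [h0]
  | succ m ih =>
    intro hm
    have h1 := ih (by omega)
    have h2 := abs_sub_apply_one_le_one (hadj m (by omega))
    rw [abs_le] at h1 h2 ⊢
    push_cast
    constructor <;> linarith [h1.1, h1.2, h2.1, h2.2]

/-- The end row of an `N`-step bridge lies in `rowOffsets N`. [cite: MadrasSlade1993, §8.2] -/
theorem apply_one_mem_rowOffsets {N : ℕ} {ω : ℕ → Site 2} (hω : ω ∈ brickBridges N) : ω N 1 ∈ rowOffsets N := by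
  rw [rowOffsets, Finset.mem_Icc]
  exact abs_le.1 (abs_apply_one_le (mem_brickBridges.1 hω).1 le_rfl)

/-- **Pigeonhole**: some row class contains at least `b_N(𝕋)/(2N+1)` of the bridges.
[cite: MadrasSlade1993, §8.2, proof of Theorem 8.2.1] -/
theorem exists_rowClass (N : ℕ) : ∃ h ∈ rowOffsets N, brickBridgeCount N ≤ (2 * N + 1) * (rowClass N h).card := by
  classical
  have hmaps : ∀ ω ∈ brickBridges N, ω N 1 ∈ rowOffsets N := fun ω hω => apply_one_mem_rowOffsets hω
  have hne : (rowOffsets N).Nonempty := ⟨0, by simp [rowOffsets]⟩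
  obtain ⟨h, hh, hmax⟩ := Finset.exists_max_image (rowOffsets N) (fun h => (rowClass N h).card) hne
  refine ⟨h, hh, ?_⟩
  rw [brickBridgeCount, Finset.card_eq_sum_card_fiberwise hmaps, ← card_rowOffsets N]
  calc ∑ b ∈ rowOffsets N, ((brickBridges N).filter fun ω => ω N 1 = b).card
      ≤ ∑ _b ∈ rowOffsets N, (rowClass N h).card := by
        refine Finset.sum_le_sum fun b hb => ?_
        have := hmax b hb
        rw [rowClass] at this
        convert this using 2
    _ = (rowOffsets N).card * (rowClass N h).card := by rw [Finset.sum_const, smul_eq_mul]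

/-! ### Reflection pairs and level bridges -/

/-- **`(#rowClass N h)² ≤ #levelBridges 2N 2N`**: `(ω, υ) ↦ ω ⊕ negWalk υ` is injective from pairs of bridges of
the row class `h` to `2N`-step bridges ending on row `h − h = 0` whose sites are within `2N` rows of the start.
[cite: MadrasSlade1993, §8.2, proof of Theorem 8.2.1] -/
theorem sq_card_rowClass_le (N : ℕ) (h : ℤ) :
    (rowClass N h).card ^ 2 ≤ (levelBridges (N + N) (N + N)).card := by
  rw [sq, ← Finset.card_product]
  refine Finset.card_le_card_of_injOn (fun p => concatWalk N p.1 (negWalk p.2)) ?_ ?_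
  · rintro ⟨ω, υ⟩ hp
    simp only [Finset.mem_coe, Finset.mem_product, mem_rowClass] at hp
    obtain ⟨⟨hω, hωe⟩, hυ, hυe⟩ := hp
    dsimp only
    have hωS := (mem_brickBridges.1 hω).1
    have hυS := (mem_brickBridges.1 hυ).1
    have hυ' : negWalk υ ∈ brickBridges N := negWalk_mem_brickBridges hυ
    have hυ'0 : negWalk υ 0 = 0 := by simp [negWalk, (mem_brickSaws.1 hυS).1]
    rw [Finset.mem_coe, mem_levelBridges]
    refine ⟨concatWalk_mem_brickBridges hω hυ', ?_, ?_⟩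
    · rw [concatWalk_apply_add _ _ hυ'0 N, Pi.add_apply, negWalk, negY_apply_one, hωe, hυe, add_neg_cancel]
    · intro m hm
      by_cases hle : m ≤ N
      · rw [concatWalk_apply_of_le _ _ hle]
        have := abs_apply_one_le hωS hle
        push_cast
        omega
      · obtain ⟨j, rfl⟩ : ∃ j, m = N + j := ⟨m - N, by omega⟩
        rw [concatWalk_apply_add _ _ hυ'0 j, Pi.add_apply]
        have h1 := abs_apply_one_le hωS (le_refl N)
        have h2 : |negWalk υ j 1| ≤ (j : ℤ) := by
          rw [negWalk, negY_apply_one, abs_neg]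
          exact abs_apply_one_le hυS (by omega)
        have h3 : (j : ℤ) ≤ N := by exact_mod_cast (show j ≤ N by omega)
        calc |ω N 1 + negWalk υ j 1| ≤ |ω N 1| + |negWalk υ j 1| := abs_add_le _ _
          _ ≤ N + N := add_le_add h1 (h2.trans h3)
          _ = ((N + N : ℕ) : ℤ) := by push_cast; ring
  · rintro ⟨ω, υ⟩ hp ⟨ω', υ'⟩ hp' hh
    simp only [Finset.mem_coe, Finset.mem_product, mem_rowClass] at hp hp'
    dsimp only at hh
    have hs := (mem_brickBridges.1 hp.1.1).1
    have hs' := (mem_brickBridges.1 hp'.1.1).1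
    have ht := negWalk_mem_brickSaws (mem_brickBridges.1 hp.2.1).1
    have ht' := negWalk_mem_brickSaws (mem_brickBridges.1 hp'.2.1).1
    obtain ⟨h1, h2⟩ := concatWalk_injective_pieces hs ht hs' ht' hh
    simp only [Prod.mk.injEq]
    exact ⟨h1, negWalk_injective h2⟩

/-- Level bridges concatenate: `#L(W,M) · #L(W,M') ≤ #L(W,M+M')` (the second piece starts on row `0` again).
[cite: MadrasSlade1993, §8.2, proof of Theorem 8.2.1] -/
theorem card_levelBridges_mul_le (W M M' : ℕ) :
    (levelBridges W M).card * (levelBridges W M').card ≤ (levelBridges W (M + M')).card := by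
  rw [← Finset.card_product]
  refine Finset.card_le_card_of_injOn (fun p => concatWalk M p.1 p.2) ?_ ?_
  · rintro ⟨ω, υ⟩ hp
    simp only [Finset.mem_coe, Finset.mem_product, mem_levelBridges] at hp
    obtain ⟨⟨hω, hωe, hωW⟩, hυ, hυe, hυW⟩ := hp
    dsimp only
    have hυ0 : υ 0 = 0 := (mem_brickSaws.1 (mem_brickBridges.1 hυ).1).1
    rw [Finset.mem_coe, mem_levelBridges]
    refine ⟨concatWalk_mem_brickBridges hω hυ, ?_, ?_⟩
    · rw [concatWalk_apply_add ω υ hυ0 M', Pi.add_apply, hωe, hυe, add_zero]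
    · intro m hm
      by_cases hle : m ≤ M
      · rw [concatWalk_apply_of_le _ _ hle]
        exact hωW m hle
      · obtain ⟨j, rfl⟩ : ∃ j, m = M + j := ⟨m - M, by omega⟩
        rw [concatWalk_apply_add _ _ hυ0, Pi.add_apply, hωe, zero_add]
        exact hυW j (by omega)
  · rintro ⟨ω, υ⟩ hp ⟨ω', υ'⟩ hp' hh
    simp only [Finset.mem_coe, Finset.mem_product, mem_levelBridges] at hp hp'
    dsimp only at hh
    obtain ⟨h1, h2⟩ := concatWalk_injective_pieces (mem_brickBridges.1 hp.1.1).1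
      (mem_brickBridges.1 hp.2.1).1 (mem_brickBridges.1 hp'.1.1).1 (mem_brickBridges.1 hp'.2.1).1 hh
    simp only [Prod.mk.injEq]
    exact ⟨h1, h2⟩

/-- The `0`-step walk is a level bridge. [cite: MadrasSlade1993, §8.2] -/
theorem brickStraightWalk_zero_mem_levelBridges (W : ℕ) : brickStraightWalk 0 ∈ levelBridges W 0 := by
  refine mem_levelBridges.2 ⟨mem_brickBridges.2 ⟨brickStraightWalk_mem_brickSaws 0, fun i h1 h2 => by omega⟩,
    ?_, fun m _ => ?_⟩
  · simp
  · simp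

/-- `#L(W,M)^j ≤ #L(W, jM)`. [cite: MadrasSlade1993, §8.2, proof of Theorem 8.2.1] -/
theorem card_levelBridges_pow_le (W M j : ℕ) : (levelBridges W M).card ^ j ≤ (levelBridges W (j * M)).card := by
  induction j with
  | zero =>
    rw [pow_zero, zero_mul]
    exact Finset.card_pos.2 ⟨_, brickStraightWalk_zero_mem_levelBridges W⟩
  | succ j ih =>
    calc (levelBridges W M).card ^ (j + 1) = (levelBridges W M).card ^ j * (levelBridges W M).card := pow_succ _ _
      _ ≤ (levelBridges W (j * M)).card * (levelBridges W M).card := Nat.mul_le_mul_right _ ih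
      _ ≤ (levelBridges W (j * M + M)).card := card_levelBridges_mul_le W _ _
      _ = (levelBridges W ((j + 1) * M)).card := by rw [Nat.succ_mul]

/-- The starting site `(0, W)` on row `W` of the cross-section. [cite: MadrasSlade1993, §8.2, eq. (8.2.14)] -/
def midStart (W : ℕ) : Site 2 := fun i => if i = 0 then 0 else W

/-- Coordinates of `midStart`. [cite: MadrasSlade1993, §8.2] -/
@[simp] theorem midStart_apply_zero (W : ℕ) : midStart W 0 = 0 := rfl

/-- Coordinates of `midStart`. [cite: MadrasSlade1993, §8.2] -/
@[simp] theorem midStart_apply_one (W : ℕ) : midStart W 1 = W := if_neg (by decide)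

/-- `midStart W` is a starting site of `S_{2W}`. [cite: MadrasSlade1993, §8.2, eq. (8.2.1)] -/
theorem midStart_mem_stripStarts (W : ℕ) : midStart W ∈ stripStarts (2 * W) := by
  refine mem_stripStarts.2 ⟨⟨?_, ?_⟩, ?_, ?_⟩
  · rw [midStart_apply_zero]
  · rw [midStart_apply_zero]; norm_num
  · show (0 : ℤ) ≤ midStart W 1
    rw [midStart_apply_one]; positivity
  · show midStart W 1 ≤ ((2 * W : ℕ) : ℤ)
    rw [midStart_apply_one]; push_cast; linarith

/-- Level bridges started on row `W` lie in `S_{2W}`: `#L(W,M) ≤ c_M(S_{2W})`.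
[cite: MadrasSlade1993, §8.2, proof of Theorem 8.2.1, eq. (8.2.14)] -/
theorem card_levelBridges_le_stripCount (W M : ℕ) : (levelBridges W M).card ≤ stripCount (2 * W) M := by
  refine Finset.card_le_card_of_injOn (fun ω => (midStart W, ω)) ?_ ?_
  · intro ω hω
    rw [Finset.mem_coe, mem_levelBridges] at hω
    obtain ⟨hω, -, hW⟩ := hω
    rw [Finset.mem_coe, mem_stripPairs]
    refine ⟨midStart_mem_stripStarts W, (mem_brickBridges.1 hω).1, fun m hm => ?_⟩
    have := abs_le.1 (hW m hm)
    refine ⟨?_, ?_⟩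
    · show (0 : ℤ) ≤ (midStart W + ω m) 1
      simp only [Pi.add_apply, midStart_apply_one]
      linarith [this.1]
    · show (midStart W + ω m) 1 ≤ ((2 * W : ℕ) : ℤ)
      simp only [Pi.add_apply, midStart_apply_one]
      push_cast
      linarith [this.2]
  · intro ω _ ω' _ hh
    simpa using hh

/-- **The counting inequality on `𝕋`**: for every `N` there is a class size `B` with `b_N(𝕋) ≤ (2N+1) · B` and
`B^{2j} ≤ c_{2jN}(S_{4N})` for all `j`. [cite: MadrasSlade1993, §8.2, proof of Theorem 8.2.1, eq. (8.2.14)] -/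
theorem exists_pow_le_stripCount (N : ℕ) :
    ∃ B : ℕ, brickBridgeCount N ≤ (2 * N + 1) * B ∧ ∀ j : ℕ, B ^ (2 * j) ≤ stripCount (4 * N) (j * (2 * N)) := by
  obtain ⟨h, -, hh⟩ := exists_rowClass N
  refine ⟨(rowClass N h).card, hh, fun j => ?_⟩
  calc (rowClass N h).card ^ (2 * j)
      = ((rowClass N h).card ^ 2) ^ j := by rw [pow_mul]
    _ ≤ (levelBridges (N + N) (N + N)).card ^ j := Nat.pow_le_pow_left (sq_card_rowClass_le N h) j
    _ ≤ (levelBridges (N + N) (j * (N + N))).card := card_levelBridges_pow_le _ _ j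
    _ ≤ stripCount (2 * (N + N)) (j * (N + N)) := card_levelBridges_le_stripCount _ _
    _ = stripCount (4 * N) (j * (2 * N)) := by ring_nf

end TriStrip

end Literature.Probability.RandomPlanarGeometry.SAW
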